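import Summits.QuantumAdvantage.QuantumAdvantage.Theorems.CharDialSubCharCombinatorics
import Summits.QuantumAdvantage.AdviceFreeQNC0.OddPrimeTransport
import Mathlib.Data.Nat.Choose.Sum
import Mathlib.Data.Nat.Choose.Dvd
import HarnessLib

/-!
# Cell qa-qnc0 / decomp-qadv (odd primes): sub-characteristic junta law, part 2/3 — degree bookkeeping and the block lemma

TREE-READY PART of the node `HOME/decomp-qadv-lens-6/g8/CharDial.lean` (decomp-qadv-lens-6 g8), ZERO `def … : Prop`.

* §7 degree bookkeeping over a field `F`: composing with a coordinate flip (`mono_comp_flip`,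
  `comp_flip_mem_lowDeg`), with the negation `negOn Z` of a set of inputs (`comp_negOn_mem_lowDeg`, `hasDegF_negOn`)
  and with the fixing `overOn Y x` of the inputs outside `Y` (`hasDegF_overOn`, via the tree's
  `comp_subst_mem_lowDeg`) does not raise the degree; `setOn T x` (set the coordinates in `T` to `1`).
* §8a `choose_pred_prime_cast : C(p−1, t) = (−1)^t` in `ZMod p` (Pascal + `p ∣ C(p, t+1)`), and the BLOCK LEMMA
  `block_constant`: if `f` is Boolean of `𝔽_p`-degree `≤ p − 2`, `Y` has `p − 1` coordinates all `0` at `x`, and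
  `f (setOn T x)` depends only on `|T|` for `T ⊆ Y` (layer symmetry), then `f` is constant on the block — the top
  Möbius coefficient `μ_Y = Σ_t (−1)^{p−1−t} C(p−1,t) g(t) = Σ_t g(t)` (in `𝔽_p`) of the restricted function
  vanishes (degree `≤ p − 2 < p − 1 = |Y|`, `SubLog.moeb_eq_zero_of_mem_lowDeg`), while a non-constant `{0,1}`-valued
  layer profile … — see the docstring of `block_constant` for the exact counting.

Imports part 1/3 and the g7 module `WalkHardFSubLog` (Möbius calculus `SubLog.*`).
-/

noncomputable section

namespace Summit.QuantumAdvantage.AdviceFreeQNC0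

namespace SubChar

open Finset
open Literature.Computability.MetaComplexity Literature.Computability.MetaComplexity.Smolensky
open SubLog

variable {n : ℕ}

/-! ### §7 Degree bookkeeping: negating inputs and fixing inputs do not raise the `𝔽_p`-degree -/

section FieldNeg

variable {F : Type*} [Field F]

/-- `x_S ∘ flipᵢ = x_{S∖i} − x_S` if `i ∈ S`, and `x_S` otherwise. -/
theorem mono_comp_flip (S : Finset (Fin n)) (i : Fin n) :
    (fun x => mono F S (flip i x)) = if i ∈ S then mono F (S.erase i) - mono F S else mono F S := by
  funext x
  split_ifs with hi
  · simp only [Pi.sub_apply, mono_apply]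
    by_cases hrest : ∀ j ∈ S.erase i, x j = true
    · rw [if_pos hrest]
      cases hxi : x i with
      | false =>
        have hall : ∀ j ∈ S, flip i x j = true := by
          intro j hj
          by_cases hji : j = i
          · subst hji; rw [flip_apply_same, hxi]; rfl
          · rw [flip_apply_of_ne hji]; exact hrest j (Finset.mem_erase.2 ⟨hji, hj⟩)
        have hnot : ¬ ∀ j ∈ S, x j = true := fun h => by
          have h' := h i hi
          rw [hxi] at h'
          exact Bool.false_ne_true h'
        rw [if_pos hall, if_neg hnot, sub_zero]
      | true =>
        have hnall : ¬ ∀ j ∈ S, flip i x j = true := fun h => by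
          have h' := h i hi
          rw [flip_apply_same, hxi] at h'
          exact Bool.false_ne_true h'
        have hall : ∀ j ∈ S, x j = true := by
          intro j hj
          by_cases hji : j = i
          · subst hji; exact hxi
          · exact hrest j (Finset.mem_erase.2 ⟨hji, hj⟩)
        rw [if_neg hnall, if_pos hall, sub_self]
    · obtain ⟨j, hj, hxj⟩ : ∃ j ∈ S.erase i, ¬ x j = true := by
        by_contra h
        push Not at h
        exact hrest fun j hj => by simpa using h j hj
      have hji : j ≠ i := (Finset.mem_erase.1 hj).1
      have hjS : j ∈ S := (Finset.mem_erase.1 hj).2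
      have h1 : ¬ ∀ j ∈ S, flip i x j = true := fun h => by
        have h' := h j hjS
        rw [flip_apply_of_ne hji] at h'
        exact hxj h'
      have h2 : ¬ ∀ j ∈ S, x j = true := fun h => hxj (h j hjS)
      rw [if_neg hrest, if_neg h1, if_neg h2, sub_zero]
  · simp only [mono_apply]
    have hiff : (∀ j ∈ S, flip i x j = true) ↔ ∀ j ∈ S, x j = true := by
      refine forall₂_congr fun j hj => ?_
      have hji : j ≠ i := fun h => hi (h ▸ hj)
      rw [flip_apply_of_ne hji]
    exact if_congr hiff rfl rfl

/-- Negating one input does not raise the degree. -/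
theorem comp_flip_mem_lowDeg (i : Fin n) {d : ℕ} {g : CubeFn F n} (hg : g ∈ lowDeg F n d) :
    (fun x => g (flip i x)) ∈ lowDeg F n d := by
  classical
  let L : CubeFn F n →ₗ[F] CubeFn F n :=
    { toFun := fun g => fun x => g (flip i x), map_add' := fun _ _ => rfl, map_smul' := fun _ _ => rfl }
  have hle : (lowDeg F n d).map L ≤ lowDeg F n d := by
    rw [lowDeg_eq_span (D := d), Submodule.map_span_le]
    rintro _ ⟨⟨A, hA⟩, rfl⟩
    show (fun x => mono F A (flip i x)) ∈ _
    rw [mono_comp_flip]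
    split_ifs with hiA
    · exact Submodule.sub_mem _ (mono_mem_lowDeg ((Finset.card_erase_le).trans hA)) (mono_mem_lowDeg hA)
    · exact mono_mem_lowDeg hA
  exact hle (Submodule.mem_map_of_mem hg)

/-- Negate the inputs in `Z`. -/
def negOn (Z : Finset (Fin n)) (x : Fin n → Bool) : Fin n → Bool := fun i => if i ∈ Z then !x i else x i

/-- CharDial sub-characteristic helper `negOn_insert` (lens-6 g8 LAND package; see the module docstring). -/
theorem negOn_insert {Z : Finset (Fin n)} {i : Fin n} (hi : i ∉ Z) (x : Fin n → Bool) :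
    negOn (insert i Z) x = negOn Z (flip i x) := by
  funext j
  by_cases hji : j = i
  · subst hji; simp [negOn, hi]
  · simp [negOn, hji, flip_apply_of_ne hji]

/-- CharDial sub-characteristic helper `negOn_negOn` (lens-6 g8 LAND package; see the module docstring). -/
theorem negOn_negOn (Z : Finset (Fin n)) (x : Fin n → Bool) : negOn Z (negOn Z x) = x := by
  funext j
  by_cases hj : j ∈ Z <;> simp [negOn, hj]

/-- CharDial sub-characteristic helper `negOn_flip` (lens-6 g8 LAND package; see the module docstring). -/
theorem negOn_flip (Z : Finset (Fin n)) (i : Fin n) (x : Fin n → Bool) :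
    negOn Z (flip i x) = flip i (negOn Z x) := by
  funext j
  by_cases hji : j = i
  · subst hji
    by_cases hj : j ∈ Z <;> simp [negOn, hj]
  · by_cases hj : j ∈ Z <;> simp [negOn, hj, flip_apply_of_ne hji]

/-- Negating any set of inputs does not raise the degree. -/
theorem comp_negOn_mem_lowDeg (Z : Finset (Fin n)) {d : ℕ} {g : CubeFn F n} (hg : g ∈ lowDeg F n d) :
    (fun x => g (negOn Z x)) ∈ lowDeg F n d := by
  classical
  induction Z using Finset.induction_on generalizing g with
  | empty =>
    have h : (fun x => g (negOn ∅ x)) = g := by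
      funext x
      have hx : negOn ∅ x = x := funext fun i => by
        unfold negOn
        rw [if_neg (Finset.notMem_empty i)]
      rw [hx]
    rw [h]
    exact hg
  | insert i Z hi ih =>
    have h : (fun x => g (negOn (insert i Z) x)) = fun x => (fun y => g (negOn Z y)) (flip i x) := by
      funext x
      rw [negOn_insert hi]
    rw [h]
    exact comp_flip_mem_lowDeg i (ih hg)

end FieldNeg

/-- CharDial sub-characteristic helper `hasDegF_negOn` (lens-6 g8 LAND package; see the module docstring). -/
theorem hasDegF_negOn (p : ℕ) [Fact p.Prime] (Z : Finset (Fin n)) {d : ℕ} {f : (Fin n → Bool) → Bool}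
    (hf : HasDegF p f d) : HasDegF p (fun x => f (negOn Z x)) d :=
  comp_negOn_mem_lowDeg Z hf

/-- Override `x` on `Y` by `u` (the substitution fixing the inputs outside `Y` to their values at `x`). -/
def overOn (Y : Finset (Fin n)) (x u : Fin n → Bool) : Fin n → Bool := fun i => if i ∈ Y then u i else x i

/-- CharDial sub-characteristic helper `hasDegF_overOn` (lens-6 g8 LAND package; see the module docstring). -/
theorem hasDegF_overOn (p : ℕ) [Fact p.Prime] (Y : Finset (Fin n)) (x : Fin n → Bool) {d : ℕ}
    {f : (Fin n → Bool) → Bool} (hf : HasDegF p f d) : HasDegF p (fun u => f (overOn Y x u)) d :=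
  comp_subst_mem_lowDeg (fun u => overOn Y x u)
    (fun i => if hi : i ∈ Y then Or.inr ⟨i, fun u => by simp [overOn, hi]⟩
      else Or.inl ⟨x i, fun u => by simp [overOn, hi]⟩) hf

/-- Set the coordinates in `T` to `true`. -/
def setOn (T : Finset (Fin n)) (x : Fin n → Bool) : Fin n → Bool := fun i => if i ∈ T then true else x i

/-- CharDial sub-characteristic helper `setOn_empty` (lens-6 g8 LAND package; see the module docstring). -/
theorem setOn_empty (x : Fin n → Bool) : setOn ∅ x = x := by
  funext i
  simp [setOn]

/-- CharDial sub-characteristic helper `setOn_singleton_eq_flip` (lens-6 g8 LAND package; see the module docstring). -/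
theorem setOn_singleton_eq_flip {x : Fin n → Bool} {i : Fin n} (hxi : x i = false) :
    setOn {i} x = flip i x := by
  funext j
  by_cases hji : j = i
  · subst hji; simp [setOn, hxi]
  · simp [setOn, hji, flip_apply_of_ne hji]

/-- CharDial sub-characteristic helper `overOn_vert` (lens-6 g8 LAND package; see the module docstring). -/
theorem overOn_vert {Y T : Finset (Fin n)} {x : Fin n → Bool} (hT : T ⊆ Y) (hx : ∀ i ∈ Y, x i = false) :
    overOn Y x (vert T) = setOn T x := by
  funext i
  by_cases hiY : i ∈ Y
  · by_cases hiT : i ∈ T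
    · simp [overOn, setOn, vert, hiY, hiT]
    · simp [overOn, setOn, vert, hiY, hiT, hx i hiY]
  · have hiT : i ∉ T := fun h => hiY (hT h)
    simp [overOn, setOn, hiY, hiT]

/-! ### §8 The block lemma: a layer-symmetric `(p−1)`-block above a vertex is constant (top Möbius coefficient) -/

/-- `C(p−1, t) ≡ (−1)^t (mod p)`. -/
theorem choose_pred_prime_cast (p : ℕ) [hp : Fact p.Prime] : ∀ t : ℕ, t < p →
    (((p - 1).choose t : ℕ) : ZMod p) = (-1) ^ t := by
  intro t
  induction t with
  | zero => intro _; simp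
  | succ t ih =>
    intro ht
    have h1 : (p - 1).choose t + (p - 1).choose (t + 1) = p.choose (t + 1) := by
      have h := Nat.choose_succ_succ (p - 1) t
      simp only [Nat.succ_eq_add_one, Nat.sub_add_cancel hp.out.one_lt.le] at h
      omega
    have hzero : ((p.choose (t + 1) : ℕ) : ZMod p) = 0 :=
      (ZMod.natCast_eq_zero_iff _ _).2 (hp.out.dvd_choose_self (Nat.succ_ne_zero t) ht)
    have h2 : (((p - 1).choose t : ℕ) : ZMod p) + (((p - 1).choose (t + 1) : ℕ) : ZMod p) = 0 := by
      rw [← Nat.cast_add, h1, hzero]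
    rw [eq_neg_of_add_eq_zero_right h2, ih (by omega), pow_succ]
    ring

/-- **Block lemma.** Let `f` be Boolean of `𝔽_p`-degree `≤ d ≤ p − 2`, `Y` a block of `p − 1` coordinates all `0` at
the vertex `x`, and suppose `f(x ∨ 1_T)` depends only on `|T|` for `T ⊆ Y` (LAYER SYMMETRY).  Then `f` is CONSTANT
on `{x ∨ 1_T : T ⊆ Y}`.  Proof: the Möbius coefficient `μ_Y` of the restriction vanishes (`|Y| = p − 1 > d`), and by
layer symmetry `μ_Y = Σ_t C(p−1,t)(−1)^{p−1−t}[G t] = (−1)^{p−1}·#{t < p : G t}` in `𝔽_p`; so `p ∣ #{t < p : G t} ≤ p`,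
i.e. the layer profile `G` is constant on `[0, p)`. -/
theorem block_constant (p : ℕ) [hp : Fact p.Prime] {d : ℕ} (hdp : d + 2 ≤ p) {f : (Fin n → Bool) → Bool}
    (hf : HasDegF p f d) (x : Fin n → Bool) (Y : Finset (Fin n)) (hY : Y.card = p - 1)
    (hx : ∀ i ∈ Y, x i = false)
    (hsym : ∀ T ⊆ Y, ∀ T' ⊆ Y, T.card = T'.card → f (setOn T x) = f (setOn T' x)) :
    ∀ T ⊆ Y, f (setOn T x) = f x := by
  classical
  -- the layer profile `G`
  let G : ℕ → Bool := fun t =>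
    if h : ∃ T : Finset (Fin n), T ⊆ Y ∧ T.card = t then f (setOn (Classical.choose h) x) else false
  have hG : ∀ T ⊆ Y, f (setOn T x) = G T.card := by
    intro T hT
    have h : ∃ T' : Finset (Fin n), T' ⊆ Y ∧ T'.card = T.card := ⟨T, hT, rfl⟩
    simp only [G, dif_pos h]
    exact hsym T hT _ (Classical.choose_spec h).1 (Classical.choose_spec h).2.symm
  have hG0 : f x = G 0 := by
    have h := hG ∅ (Finset.empty_subset _)
    rwa [setOn_empty, Finset.card_empty] at h
  -- the restriction of `f` to the subcube above `x` along `Y`, and its top Möbius coefficient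
  have hr : HasDegF p (fun u => f (overOn Y x u)) d := hasDegF_overOn p Y x hf
  have hvert : ∀ T ⊆ Y, indR (ZMod p) (fun u => f (overOn Y x u)) (vert T) = if G T.card = true then 1 else 0 := by
    intro T hT
    simp only [indR, overOn_vert hT hx, hG T hT]
  have htop : moeb (indR (ZMod p) (fun u => f (overOn Y x u))) Y = 0 :=
    moeb_eq_zero_of_mem_lowDeg ((hasDegF_iff_indR p _ d).1 hr) (by rw [hY]; omega)
  have hp1 : p - 1 + 1 = p := Nat.sub_add_cancel hp.out.one_lt.le
  -- evaluate the top coefficient layer by layer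
  have hsum : moeb (indR (ZMod p) (fun u => f (overOn Y x u))) Y =
      (-1) ^ (p - 1) * (((range p).filter fun t => G t = true).card : ZMod p) := by
    unfold moeb
    have h1 : ∀ T ∈ Y.powerset, (-1 : ZMod p) ^ (Y.card - T.card) * indR (ZMod p) (fun u => f (overOn Y x u)) (vert T)
        = (fun t : ℕ => (-1 : ZMod p) ^ (p - 1 - t) * (if G t = true then (1 : ZMod p) else 0)) T.card := by
      intro T hT
      rw [hvert T (Finset.mem_powerset.1 hT), hY]
    rw [Finset.sum_congr rfl h1,
      Finset.sum_powerset_apply_card (fun t : ℕ => (-1 : ZMod p) ^ (p - 1 - t) * (if G t = true then (1 : ZMod p) else 0)),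
      hY, hp1]
    have h2 : ∀ t ∈ range p, (p - 1).choose t •
        (fun t : ℕ => (-1 : ZMod p) ^ (p - 1 - t) * (if G t = true then (1 : ZMod p) else 0)) t =
        (-1) ^ (p - 1) * (if G t = true then (1 : ZMod p) else 0) := by
      intro t ht
      have ht' : t < p := Finset.mem_range.1 ht
      dsimp only
      rw [nsmul_eq_mul, choose_pred_prime_cast p t ht', ← mul_assoc, ← pow_add,
        show t + (p - 1 - t) = p - 1 by omega]
    rw [Finset.sum_congr rfl h2, ← Finset.mul_sum, Finset.sum_boole]
  rw [hsum] at htop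
  have hAcast : (((range p).filter fun t => G t = true).card : ZMod p) = 0 := by
    rcases mul_eq_zero.1 htop with h | h
    · exact absurd h (pow_ne_zero _ (neg_ne_zero.2 one_ne_zero))
    · exact h
  have hdvd : p ∣ ((range p).filter fun t => G t = true).card := (ZMod.natCast_eq_zero_iff _ _).1 hAcast
  have hmemA : ∀ t, t ∈ ((range p).filter fun t => G t = true) ↔ t < p ∧ G t = true := fun t => by
    rw [Finset.mem_filter, Finset.mem_range]
  have hAle : ((range p).filter fun t => G t = true).card ≤ p :=
    (Finset.card_le_card (Finset.filter_subset _ _)).trans (by rw [Finset.card_range])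
  -- hence the layer profile is constant on `[0, p)`
  have hGconst : ∀ t < p, G t = G 0 := by
    rcases Nat.eq_zero_or_pos ((range p).filter fun t => G t = true).card with h0 | hpos
    · have hAe := Finset.card_eq_zero.1 h0
      have hall : ∀ t < p, G t = false := by
        intro t ht
        by_contra hc
        have hmem : t ∈ ((range p).filter fun t => G t = true) := (hmemA t).2 ⟨ht, by simpa using hc⟩
        rw [hAe] at hmem
        exact Finset.notMem_empty t hmem
      intro t ht
      rw [hall t ht, hall 0 hp.out.pos]
    · have hAp : ((range p).filter fun t => G t = true).card = p := by
        obtain ⟨k, hk⟩ := hdvd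
        rcases k with _ | k
        · rw [hk] at hpos; simp at hpos
        · have hk1 : p * (k + 1) ≤ p * 1 := by rw [mul_one, ← hk]; exact hAle
          have := Nat.le_of_mul_le_mul_left hk1 hp.out.pos
          have hk0 : k = 0 := by omega
          rw [hk, hk0]
          omega
      have hAeq : ((range p).filter fun t => G t = true) = range p :=
        Finset.eq_of_subset_of_card_le (Finset.filter_subset _ _) (by rw [Finset.card_range, hAp])
      intro t ht
      have ht1 : G t = true := ((hmemA t).1 (by rw [hAeq]; exact Finset.mem_range.2 ht)).2
      have h01 : G 0 = true := ((hmemA 0).1 (by rw [hAeq]; exact Finset.mem_range.2 hp.out.pos)).2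
      rw [ht1, h01]
  intro T hT
  have hTcard : T.card < p := by
    have h := Finset.card_le_card hT
    rw [hY] at h
    have := hp.out.one_lt
    omega
  rw [hG T hT, hGconst _ hTcard, ← hG0]


end SubChar

end Summit.QuantumAdvantage.AdviceFreeQNC0

end
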